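import Literature.AnabelianGeometry.SemiGraphs.ArithMaximalCompact
import Literature.AnabelianGeometry.SemiGraphs.TreeSystemStarCondition
import HarnessLib

/-!
# [SemiAnbd] Thm 5.4 (i): the ONE use of arithmetic ampleness — an arithmetically ample compact
# subgroup fixes no compatible finite-level branch-pair system, hence satisfies (∗_j)

Mochizuki, *Semi-graphs of anabelioids*, Publ. RIMS **42** (2006) 221–322, §5, Def. 5.3 and Thm. 5.4
(i), manuscript pp. 65–66 [cite: MochizukiSemiAnbd2006, Thm 5.4 (i) p.66]: "Proof. Modulo the evident
'arithmetic translation' — e.g., 'nontrivial' is to be replaced by 'arithmetically ample' and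
'estranged' by 'arithmetically estranged' — the proofs are entirely parallel to those of Theorem 3.7,
Corollary 3.9." In the cell's proof of Theorem 3.7 (iii) (author's Comments (6)), total estrangement
is used at ONE place: a nontrivial compact `H` fixing a compatible system of finite-level branch pairs
`(w_i; β_i ≠ β'_i)` would lie (Rmk. 2.2.1) in an intersection `Π_b ∩ h·Π_{b'}·h⁻¹` of the kind
Def. 2.4 (iv) declares trivial — whence the hypothesis `hnobp` ("no fixed branch-pair system") of
abc-iut-L3-t11's GENERIC `SemiGraph.hstar_of_noFixedBranchPairSystem` (`TreeSystemStarCondition.lean`),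
which turns it into the condition (∗_j). This PROOF-ONLY file (abc-iut cell, D-0068 sub-DAG
`SUBDAG-SemiAnbd-Thm54.md` row T54-3, SECOND seat abc-iut-w4-d029 for holder abc-iut-w4-d059's route
S4) supplies the ARITHMETIC TRANSLATION of exactly that place, over abc-iut-L3-t3's data of p. 65
(`DecompositionData`, `IsArithAmple`, `IsTotallyArithEstranged`, `conjSubgroup`; `ArithMaximalCompact.lean`):

* ("nontrivial ↦ arithmetically ample": an overgroup of an arithmetically ample subgroup is ample —
  `Subgroup.isOpen_mono`, inlined; named `IsArithAmple.mono` in abc-iut-w4-d085's `ArithMaximalCompactReductions`);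
  `isArithAmple_conjSubgroup_iff` (with the private helper `map_conjSubgroup`) — ampleness is conjugation-invariant; `ne_bot_of_isArithAmple` —
  an ample subgroup is nontrivial as soon as `⊥` is not ample (i.e. `Π_A` is not discrete; print's
  `Π_A` is an infinite profinite group — abc-iut-w4-d059's typing observation O-T54-3);
* `not_le_of_isTotallyArithEstranged` — **the estrangement contradiction**: under
  `IsTotallyArithEstranged D aug`, an arithmetically ample subgroup lies in NO conjugate of an
  intersection `Π_b ⊓ h·Π_{b'}·h⁻¹` with `b, b'` abutting to one vertex `v`, `h ∈ Π_v`, and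
  `b' ≠ b` or `h ∉ Π_b` (Def. 5.3 (ii));
* `hnobp_of_isArithAmple` — given the ARITHMETIC BRANCH-PAIR DICTIONARY (AI4′) as an explicit binder `hdict`
  (no definition is introduced; the twin of
  `FiniteLevelData.stabBranchPair'`: the stabiliser of a compatible finite-level branch-pair system lies
  in such a conjugate-intersection; producer row T54-0), an arithmetically ample `C` satisfies t11's
  hypothesis `hnobp` VERBATIM (its conclusion `C = ⊥` is reached through `False`);
* `hstar_of_isArithAmple` — the composite with `SemiGraph.hstar_of_noFixedBranchPairSystem`: (∗_j) for
  every arithmetically ample `C` over any tree/level system carrying (AI4′) — the input the holder's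
  assembly consumes where `TemperedCompactInVerticialHstar` consumes `hstar`.

Honest scope: statements about the abstract data (binders); no Thm 3.7 fact is consumed; nothing here
takes a side on [IUTchIII] Cor. 3.12; typed ≠ proved elsewhere.
-/

namespace Literature.AnabelianGeometry.SemiGraphs

open CategoryTheory Topology

universe v u u' w w'

/-! ### The arithmetic-translation atoms (Def. 5.3 (i), (ii)) -/

section Atoms

variable {Gtp : Type u} [Group Gtp]
variable {PA : Type u'} [Group PA] [TopologicalSpace PA] [IsTopologicalGroup PA]
variable {V : Type w} {B : Type w'}

omit [TopologicalSpace PA] [IsTopologicalGroup PA] in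
/-- The image in `Π_A` of a conjugate is the conjugate of the image. [folklore] -/
private theorem map_conjSubgroup (aug : Gtp →* PA) (g : Gtp) (K : Subgroup Gtp) :
    (conjSubgroup g K).map aug = (K.map aug).map (MulAut.conj (aug g)).toMonoidHom := by
  simp only [conjSubgroup, Subgroup.map_map]
  congr 1
  ext x
  simp

/-- Arithmetic ampleness is invariant under conjugation (conjugation by `aug g` is a homeomorphism of
`Π_A`). [cite: MochizukiSemiAnbd2006, Def 5.3 (i) p.65] -/
theorem isArithAmple_conjSubgroup_iff (aug : Gtp →* PA) (g : Gtp) (K : Subgroup Gtp) :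
    IsArithAmple aug (conjSubgroup g K) ↔ IsArithAmple aug K := by
  unfold IsArithAmple
  rw [map_conjSubgroup]
  have hφ : ((K.map aug).map (MulAut.conj (aug g)).toMonoidHom : Set PA) =
      (Homeomorph.mulLeft (aug g)).trans (Homeomorph.mulRight (aug g)⁻¹) '' (K.map aug : Set PA) := by
    ext x
    simp only [Subgroup.coe_map, MulEquiv.coe_toMonoidHom, MulAut.conj_apply, Set.mem_image,
      SetLike.mem_coe, Homeomorph.trans_apply, Homeomorph.coe_mulLeft, Homeomorph.coe_mulRight]
  rw [hφ]
  exact Homeomorph.isOpen_image _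

omit [IsTopologicalGroup PA] in
/-- An arithmetically ample subgroup is nontrivial — provided `⊥` is not arithmetically ample, i.e.
`Π_A` is not discrete (abc-iut-w4-d059's observation O-T54-3: for discrete `Π_A` Thm 5.4 (i) as typed
fails; print's `Π_A` is the BC-fundamental group, infinite profinite). [cite: MochizukiSemiAnbd2006, Def 5.3 (i) p.65] -/
theorem ne_bot_of_isArithAmple {aug : Gtp →* PA} (hbot : ¬ IsArithAmple aug ⊥) {C : Subgroup Gtp}
    (hC : IsArithAmple aug C) : C ≠ ⊥ := by
  rintro rfl
  exact hbot hC

/-- **The estrangement contradiction** ("estranged ↦ arithmetically estranged", proof of Thm 5.4 (i)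
p.66 via Def 5.3 (ii) p.65): if every edge is arithmetically estranged, an arithmetically ample subgroup
lies in NO conjugate `x · (Π_b ∩ h·Π_{b'}·h⁻¹) · x⁻¹` with `b`, `b'` abutting to one vertex `v`,
`h ∈ Π_v`, and either `b' ≠ b` or `h ∉ Π_b` — for that intersection would then be arithmetically ample.
[cite: MochizukiSemiAnbd2006, Def 5.3 (ii) p.65] -/
theorem not_le_of_isTotallyArithEstranged {D : DecompositionData Gtp V B} {aug : Gtp →* PA}
    (hest : IsTotallyArithEstranged D aug) {C : Subgroup Gtp} (hC : IsArithAmple aug C)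
    {b b' : B} {v : V} (hb : D.abut b = some v) (hb' : D.abut b' = some v) {h : Gtp}
    (hh : h ∈ D.vertGp v) (hbb : b' ≠ b ∨ h ∉ D.brGp b) (x : Gtp) :
    ¬ C ≤ conjSubgroup x (D.brGp b ⊓ conjSubgroup h (D.brGp b')) := by
  intro hle
  have hamp : IsArithAmple aug (D.brGp b ⊓ conjSubgroup h (D.brGp b')) :=
    (isArithAmple_conjSubgroup_iff aug x _).1 (Subgroup.isOpen_mono (Subgroup.map_mono hle) hC)
  obtain ⟨h1, h2⟩ := hest (D.edgeOf b) b rfl v hb h hh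
  by_cases hne : b' = b
  · subst hne
    rcases hbb with hne' | hnot
    · exact hne' rfl
    · exact h2 hnot hamp
  · exact h1 b' hb' hne hamp

end Atoms

/-! ### No fixed branch-pair system for an arithmetically ample subgroup; (∗_j) -/

section NoBranchPair

variable {Gtp : Type u} [Group Gtp]
variable {PA : Type u'} [Group PA] [TopologicalSpace PA] [IsTopologicalGroup PA]
variable {V : Type w} {B : Type w'}
variable (D : DecompositionData Gtp V B) (aug : Gtp →* PA)
variable {J : Type v} [Preorder J]
variable (G : J → SemiGraph.{u}) (τ : ∀ j, Gtp →* Aut (G j))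
variable (gf : ∀ ⦃i j : J⦄, i ≤ j → (G j ⟶ G i))

variable {D aug G τ gf}

/-! The ARITHMETIC BRANCH-PAIR DICTIONARY (AI4′) — the twin of `ProfiniteSemiGraph.FiniteLevelData.stabBranchPair'`
(Remark 2.2.1 at branch level): "the pointwise stabiliser of a compatible system `(w_i; β_i ≠ β'_i)` of a level
vertex with two distinct abutting branches lies in a conjugate `x·(Π_b ∩ h·Π_{b'}·h⁻¹)·x⁻¹` for some base vertex
`v`, branches `b, b'` abutting to `v`, `h ∈ Π_v` with `b' ≠ b` or `h ∉ Π_b`" — enters the two theorems below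
as the explicit hypothesis `hdict` (producer: sub-DAG row T54-0); no definition and no named fact is introduced
here (cell rule D-0067: no new `Prop` facts inside the cone). -/

/-- **An arithmetically ample subgroup fixes no compatible finite-level branch-pair system** (the ONE use
of ampleness in the proof of Thm 5.4 (i), p.66 with p.41): given the dictionary (AI4′) and total arithmetic
estrangement, an arithmetically ample `C` satisfies the hypothesis `hnobp` of abc-iut-L3-t11's
`SemiGraph.hstar_of_noFixedBranchPairSystem` verbatim — if `C` fixed such a system it would lie in an
estranged conjugate-intersection, which would then be arithmetically ample: absurd.
[cite: MochizukiSemiAnbd2006, Thm 5.4 (i) p.66] -/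
theorem hnobp_of_isArithAmple
    (hdict : ∀ (j₀ : J) (w : ∀ i : {i : J // j₀ ≤ i}, (G i.1).Vertex)
      (β β' : ∀ i : {i : J // j₀ ≤ i}, (G i.1).Branch),
      (∀ i, β i ≠ β' i ∧ (G i.1).abuts (β i) = some (w i) ∧ (G i.1).abuts (β' i) = some (w i)) →
      (∀ ⦃i i' : {i : J // j₀ ≤ i}⦄ (h : i.1 ≤ i'.1), (gf h).vertexMap (w i') = w i ∧
        (gf h).branchMap (β i') = β i ∧ (gf h).branchMap (β' i') = β' i) →
      ∃ (v : V) (b b' : B) (x h : Gtp), D.abut b = some v ∧ D.abut b' = some v ∧ h ∈ D.vertGp v ∧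
        (b' ≠ b ∨ h ∉ D.brGp b) ∧
        ∀ g : Gtp, (∀ i, (τ i.1 g).hom.vertexMap (w i) = w i ∧
          (τ i.1 g).hom.branchMap (β i) = β i ∧ (τ i.1 g).hom.branchMap (β' i) = β' i) →
          g ∈ conjSubgroup x (D.brGp b ⊓ conjSubgroup h (D.brGp b')))
    (hest : IsTotallyArithEstranged D aug) (C : Subgroup Gtp) (hC : IsArithAmple aug C)
    (j₀ : J) (w : ∀ i : {i : J // j₀ ≤ i}, (G i.1).Vertex)
    (β β' : ∀ i : {i : J // j₀ ≤ i}, (G i.1).Branch)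
    (hββ : ∀ i, β i ≠ β' i ∧ (G i.1).abuts (β i) = some (w i) ∧ (G i.1).abuts (β' i) = some (w i))
    (hcompat : ∀ ⦃i i' : {i : J // j₀ ≤ i}⦄ (h : i.1 ≤ i'.1), (gf h).vertexMap (w i') = w i ∧
      (gf h).branchMap (β i') = β i ∧ (gf h).branchMap (β' i') = β' i)
    (hfix : ∀ (i : {i : J // j₀ ≤ i}) (γ : C), (τ i.1 γ).hom.vertexMap (w i) = w i ∧
      (τ i.1 γ).hom.branchMap (β i) = β i ∧ (τ i.1 γ).hom.branchMap (β' i) = β' i) :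
    C = ⊥ := by
  obtain ⟨v, b, b', x, h, hb, hb', hh, hbb, hstab⟩ := hdict j₀ w β β' hββ hcompat
  exact absurd (fun g hg => hstab g fun i => hfix i ⟨g, hg⟩)
    (not_le_of_isTotallyArithEstranged hest hC hb hb' hh hbb x)

/-- **(∗_j) for an arithmetically ample subgroup** (Comments (6)(b) in the arithmetic setting): over any
directed system of trees `T_j` with `Π^temp_𝔊`-actions, finite levels `𝔾_j` (immersions `T_j ⟶ 𝔾_j`,
equivariant, compatible transitions) carrying the dictionary (AI4′), and under total arithmetic
estrangement, every arithmetically ample `C` (with `⊥` not ample) satisfies: for every `j` there is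
`i ≥ j` such that all `C`-fixed edges of `T_i` have ONE image in `T_j` — abc-iut-L3-t11's
`SemiGraph.hstar_of_noFixedBranchPairSystem` fed with `hnobp_of_isArithAmple`.
[cite: MochizukiSemiAnbd2006, Thm 5.4 (i) p.66] -/
theorem hstar_of_isArithAmple [IsDirectedOrder J]
    (T : J → SemiGraph.{u}) (hT : ∀ j, (T j).IsTree) (ρ : ∀ j, Gtp →* Aut (T j))
    (f : ∀ ⦃i j : J⦄, i ≤ j → (T j ⟶ T i))
    [∀ j, Finite (G j).Vertex] [∀ j, Finite (G j).Branch]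
    (q : ∀ j, T j ⟶ G j) (hq : ∀ j, SemiGraph.IsImmersion (q j))
    (hqe : ∀ (j : J) (g : Gtp), (ρ j g).hom ≫ q j = q j ≫ (τ j g).hom)
    (gf_id : ∀ j, gf (le_refl j) = 𝟙 (G j))
    (gf_comp : ∀ ⦃i j k : J⦄ (hij : i ≤ j) (hjk : j ≤ k), gf hjk ≫ gf hij = gf (hij.trans hjk))
    (hgfe : ∀ ⦃i j : J⦄ (h : i ≤ j) (g : Gtp), (τ j g).hom ≫ gf h = gf h ≫ (τ i g).hom)
    (hsq : ∀ ⦃i j : J⦄ (h : i ≤ j), f h ≫ q i = q j ≫ gf h)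
    (hdict : ∀ (j₀ : J) (w : ∀ i : {i : J // j₀ ≤ i}, (G i.1).Vertex)
      (β β' : ∀ i : {i : J // j₀ ≤ i}, (G i.1).Branch),
      (∀ i, β i ≠ β' i ∧ (G i.1).abuts (β i) = some (w i) ∧ (G i.1).abuts (β' i) = some (w i)) →
      (∀ ⦃i i' : {i : J // j₀ ≤ i}⦄ (h : i.1 ≤ i'.1), (gf h).vertexMap (w i') = w i ∧
        (gf h).branchMap (β i') = β i ∧ (gf h).branchMap (β' i') = β' i) →
      ∃ (v : V) (b b' : B) (x h : Gtp), D.abut b = some v ∧ D.abut b' = some v ∧ h ∈ D.vertGp v ∧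
        (b' ≠ b ∨ h ∉ D.brGp b) ∧
        ∀ g : Gtp, (∀ i, (τ i.1 g).hom.vertexMap (w i) = w i ∧
          (τ i.1 g).hom.branchMap (β i) = β i ∧ (τ i.1 g).hom.branchMap (β' i) = β' i) →
          g ∈ conjSubgroup x (D.brGp b ⊓ conjSubgroup h (D.brGp b')))
    (hest : IsTotallyArithEstranged D aug)
    (hbot : ¬ IsArithAmple aug ⊥) (C : Subgroup Gtp) (hC : IsArithAmple aug C) (j : J) :
    ∃ (i : J) (h : j ≤ i), ∀ e e' : (T i).Edge, (∀ γ : C, (ρ i γ).hom.edgeMap e = e) →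
      (∀ γ : C, (ρ i γ).hom.edgeMap e' = e') → (f h).edgeMap e = (f h).edgeMap e' :=
  SemiGraph.hstar_of_noFixedBranchPairSystem C T hT ρ f G τ q hq hqe gf gf_id gf_comp hgfe hsq
    (fun j₀ w β β' hββ hcompat hfix => hnobp_of_isArithAmple hdict hest C hC j₀ w β β' hββ hcompat hfix)
    (ne_bot_of_isArithAmple hbot hC) j

end NoBranchPair

end Literature.AnabelianGeometry.SemiGraphs
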